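import Summits.CriticalPhenomena.PercolationContinuityZ3.Theorems.PercNearOneGluingNoHeavyLowerTailAntipodalR1TwoCutPaths
import HarnessLib

/-!
# ANTI₁ across a 2-separation, II: replacing the far side by a gadget with the same state

Support file for `stmt-CriticalPhenomena-4575` (memo `prim-gen-kcluster/KCLUSTER-gen76.md` §2 / §8 (N4);
conjecture ANTI₁ of `KCLUSTER-gen52.md` §3).  No definitions, no named facts, no sorries.  Vocabulary of
`AntipodalR1` (`nbr`, `clus`, `freeNbr`, `region`, `lSet`, `rSet`; gen 62) and the cluster
correspondence of `…AntipodalR1TwoCutPaths` (gen 78).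

Setting (as in part I).  `G = G₁ ∪ G₂` glued along `{u, v}`: the system
`Sum.elim ends₁ ends₂ : ι₁ ⊕ ι₂ → Sym2 V`, every vertex met by an edge of `G₁` non-interior for `G₂`
(`∀ j, w ∈ ends₂ j → w = u ∨ w = v`), and the apex `a` and both terminals `b, c` non-interior.  The
*gadget system* is `G' = G₁ ∪ P_κ`, where `P_κ = fun _ : κ => s(u, v)` is a bunch of parallel `u–v`
edges indexed by a type `κ` (below: `κ = Unit` or `κ = Bool`; `κ` empty is the bare side `G₁`, treated
separately).  A colouring `ω'` of `G'` has *the same state* as a colouring `ω` of `G` when they agree on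
`G₁` and, for both colours `col`, `u, v` are `col`-joined inside `G₂` under `ω` iff some gadget edge has
colour `col` under `ω'` (or `u = v`) — `AntipodalR1.mem_clus_parallel_iff`.

Results (all [this work]):
* `mem_clus_iff_gadget` — clusters of `a` agree on non-interior vertices (`G` vs `G'`, same state);
* `region_of_gadget` — a `b–c` path of `G'` avoiding `K_a` lifts to one of `G` (the gadget edge is
  replaced by a path of `G₂`, whose interior vertices avoid `K_a` because `u, v ∉ K_a` and an interior
  vertex lies in `K_a` only if `u` or `v` does);
* `mem_lSet_gadget_of_mem_lSet` (`ω ∈ L(G) ⟹ ω' ∈ L(G')`) and `mem_rSet_of_mem_rSet_gadget`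
  (`ω' ∈ R(G') ⟹ ω ∈ R(G)`);
* the same two transfers for the bare side `G₁` when `u, v` are joined inside `G₂` by neither colour
  (`mem_lSet_inl_of_mem_lSet`, `mem_rSet_of_mem_rSet_inl`).
Part III (`…AntipodalR1TwoCut`) does the counting.
-/

namespace Summit.CriticalPhenomena.PercolationContinuityZ3.Theorems

namespace AntipodalR1

open Finset Relation

variable {V ι ι₁ ι₂ κ : Type*}

/-- **State of a bunch of parallel edges.**  For the system `fun _ : κ => s(u, v)` coloured by `g`:
`u, v` are `col`-joined iff `u = v` or some edge has colour `col`. [this work] -/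
theorem mem_clus_parallel_iff {u v : V} {g : κ → Bool} {col : Bool} :
    v ∈ clus (fun _ : κ => s(u, v)) g col u ↔ u = v ∨ ∃ k, g k = col := by
  constructor
  · intro h
    rcases (mem_clus.1 h).cases_head with huv | ⟨w, ⟨k, hk, _⟩, _⟩
    · exact Or.inl huv
    · exact Or.inr ⟨k, hk⟩
  · rintro (rfl | ⟨k, hk⟩)
    · exact ReflTransGen.refl
    · exact ReflTransGen.single ⟨k, hk, rfl⟩

/-- Every vertex is non-interior for a bunch of parallel `u–v` edges. [this work] -/
theorem nonInt_parallel (u v w : V) : ∀ j : κ, w ∈ (fun _ : κ => s(u, v)) j → w = u ∨ w = v :=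
  fun _ h => Sym2.mem_iff.1 h

section Gadget

/-! ### The glued system versus the gadget system with the same state -/

variable {ends₁ : ι₁ → Sym2 V} {ends₂ : ι₂ → Sym2 V} {u v a : V}
  {ω : ι₁ ⊕ ι₂ → Bool} {ω' : ι₁ ⊕ κ → Bool}

/-- **Clusters.**  Same state ⟹ the `col`-clusters of `a` in `G` and in the gadget system `G'` agree
on non-interior vertices. [this work] -/
theorem mem_clus_iff_gadget
    (hsep : ∀ w i, w ∈ ends₁ i → ∀ j, w ∈ ends₂ j → w = u ∨ w = v)
    (ha : ∀ j, a ∈ ends₂ j → a = u ∨ a = v)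
    (hω : ∀ i, ω (Sum.inl i) = ω' (Sum.inl i))
    (hst : ∀ col, v ∈ clus ends₂ (fun j => ω (Sum.inr j)) col u ↔ (u = v ∨ ∃ k, ω' (Sum.inr k) = col))
    {col : Bool} {x : V} (hxN : ∀ j, x ∈ ends₂ j → x = u ∨ x = v) :
    x ∈ clus (Sum.elim ends₁ ends₂) ω col a ↔
      x ∈ clus (Sum.elim ends₁ (fun _ : κ => s(u, v))) ω' col a :=
  mem_clus_iff_of_sameState hsep (fun w _ _ => nonInt_parallel u v w) ha (nonInt_parallel u v a) hω
    ((hst col).trans mem_clus_parallel_iff.symm) hxN (nonInt_parallel u v x)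

/-- **Paths of `G₂` avoid `K_a`.**  If `u, v ∉ K_a(ω)` then every vertex `col`-joined to `u` inside
`G₂` avoids `K_a(ω)`, and is joined to `u` by a support path of `G` avoiding `K_a(ω)`. [this work] -/
theorem freePath_of_clus₂
    (hsep : ∀ w i, w ∈ ends₁ i → ∀ j, w ∈ ends₂ j → w = u ∨ w = v)
    (ha : ∀ j, a ∈ ends₂ j → a = u ∨ a = v)
    (huK : u ∉ clus (Sum.elim ends₁ ends₂) ω false a) (hvK : v ∉ clus (Sum.elim ends₁ ends₂) ω false a)
    {col : Bool} {z : V} (hz : z ∈ clus ends₂ (fun j => ω (Sum.inr j)) col u) :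
    z ∉ clus (Sum.elim ends₁ ends₂) ω false a ∧
      ReflTransGen (fun p q => q ∈ freeNbr (Sum.elim ends₁ ends₂) ω a p) u z := by
  rw [mem_clus] at hz
  induction hz with
  | refl => exact ⟨huK, ReflTransGen.refl⟩
  | @tail y z _ hyz ih =>
    obtain ⟨j, _, hends⟩ := hyz
    have hzK : z ∉ clus (Sum.elim ends₁ ends₂) ω false a := by
      intro hzK
      by_cases hzN : ∀ j, z ∈ ends₂ j → z = u ∨ z = v
      · rcases hzN j (by rw [hends]; exact Sym2.mem_mk_right _ _) with rfl | rfl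
        · exact huK hzK
        · exact hvK hzK
      · rcases clus_left_or_right_of_interior hsep ha hzN hzK with h | h
        · exact huK h
        · exact hvK h
    exact ⟨hzK, ih.2.tail ⟨⟨Sum.inr j, hends⟩, ih.1, hzK⟩⟩

/-- **Regions.**  Same state, `b` non-interior ⟹ a support path of the gadget system from `b` avoiding
its `K_a` lifts to a support path of `G` avoiding `K_a(ω)` (gadget edges are replaced by paths of `G₂`).
[this work] -/
theorem region_of_gadget {b : V}
    (hsep : ∀ w i, w ∈ ends₁ i → ∀ j, w ∈ ends₂ j → w = u ∨ w = v)
    (ha : ∀ j, a ∈ ends₂ j → a = u ∨ a = v) (hb : ∀ j, b ∈ ends₂ j → b = u ∨ b = v)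
    (hω : ∀ i, ω (Sum.inl i) = ω' (Sum.inl i))
    (hst : ∀ col, v ∈ clus ends₂ (fun j => ω (Sum.inr j)) col u ↔ (u = v ∨ ∃ k, ω' (Sum.inr k) = col))
    {x : V} (hx : x ∈ region (Sum.elim ends₁ (fun _ : κ => s(u, v))) ω' a b) :
    x ∈ region (Sum.elim ends₁ ends₂) ω a b := by
  rw [mem_region] at hx ⊢
  suffices h : (∀ j, x ∈ ends₂ j → x = u ∨ x = v) ∧
      ReflTransGen (fun p q => q ∈ freeNbr (Sum.elim ends₁ ends₂) ω a p) b x from h.2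
  induction hx with
  | refl => exact ⟨hb, ReflTransGen.refl⟩
  | @tail y z _ hyz ih =>
    obtain ⟨⟨e, he⟩, hyK', hzK'⟩ := hyz
    have hyK : y ∉ clus (Sum.elim ends₁ ends₂) ω false a :=
      fun h => hyK' ((mem_clus_iff_gadget hsep ha hω hst ih.1).1 h)
    cases e with
    | inl i =>
      have hzN : ∀ j, z ∈ ends₂ j → z = u ∨ z = v :=
        hsep z i (by rw [show ends₁ i = s(y, z) from he]; exact Sym2.mem_mk_right _ _)
      have hzK : z ∉ clus (Sum.elim ends₁ ends₂) ω false a :=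
        fun h => hzK' ((mem_clus_iff_gadget hsep ha hω hst hzN).1 h)
      exact ⟨hzN, ih.2.tail ⟨⟨Sum.inl i, he⟩, hyK, hzK⟩⟩
    | inr k =>
      have huv : s(u, v) = s(y, z) := he
      -- both ends of the gadget edge are `u`, `v`; both avoid `K_a(ω)`
      have huK' : u ∉ clus (Sum.elim ends₁ (fun _ : κ => s(u, v))) ω' false a := by
        rcases Sym2.eq_iff.1 huv with ⟨rfl, -⟩ | ⟨rfl, -⟩
        · exact hyK'
        · exact hzK'
      have hvK' : v ∉ clus (Sum.elim ends₁ (fun _ : κ => s(u, v))) ω' false a := by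
        rcases Sym2.eq_iff.1 huv with ⟨-, rfl⟩ | ⟨-, rfl⟩
        · exact hzK'
        · exact hyK'
      have huK : u ∉ clus (Sum.elim ends₁ ends₂) ω false a :=
        fun h => huK' ((mem_clus_iff_gadget hsep ha hω hst (fun _ _ => Or.inl rfl)).1 h)
      have hvK : v ∉ clus (Sum.elim ends₁ ends₂) ω false a :=
        fun h => hvK' ((mem_clus_iff_gadget hsep ha hω hst (fun _ _ => Or.inr rfl)).1 h)
      -- the gadget edge `k` certifies a path of `G₂` of its own colour from `u` to `v`
      have hpath : v ∈ clus ends₂ (fun j => ω (Sum.inr j)) (ω' (Sum.inr k)) u :=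
        (hst _).2 (Or.inr ⟨k, rfl⟩)
      have hfree := (freePath_of_clus₂ hsep ha huK hvK hpath).2
      rcases Sym2.eq_iff.1 huv with ⟨rfl, rfl⟩ | ⟨rfl, rfl⟩
      · exact ⟨fun _ _ => Or.inr rfl, ih.2.trans hfree⟩
      · exact ⟨fun _ _ => Or.inl rfl, ih.2.trans (region_symm hfree)⟩

variable [Fintype ι₁] [DecidableEq ι₁] [Fintype ι₂] [DecidableEq ι₂] [Fintype κ] [DecidableEq κ]

/-- **`L` transfers to the gadget system.**  Same state, `a, b, c` non-interior:
`ω ∈ L(G; a, b, c) ⟹ ω' ∈ L(G'; a, b, c)`. [this work] -/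
theorem mem_lSet_gadget_of_mem_lSet {b c : V}
    (hsep : ∀ w i, w ∈ ends₁ i → ∀ j, w ∈ ends₂ j → w = u ∨ w = v)
    (ha : ∀ j, a ∈ ends₂ j → a = u ∨ a = v) (hb : ∀ j, b ∈ ends₂ j → b = u ∨ b = v)
    (hc : ∀ j, c ∈ ends₂ j → c = u ∨ c = v)
    (hω : ∀ i, ω (Sum.inl i) = ω' (Sum.inl i))
    (hst : ∀ col, v ∈ clus ends₂ (fun j => ω (Sum.inr j)) col u ↔ (u = v ∨ ∃ k, ω' (Sum.inr k) = col))
    (hx : ω ∈ lSet (Sum.elim ends₁ ends₂) a b c) :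
    ω' ∈ lSet (Sum.elim ends₁ (fun _ : κ => s(u, v))) a b c := by
  classical
  obtain ⟨hOb, hKb, hOc, hKc, hbc⟩ := (mem_filter.1 hx).2
  refine mem_filter.2 ⟨mem_univ _, (mem_clus_iff_gadget hsep ha hω hst hb).1 hOb,
    fun h => hKb ((mem_clus_iff_gadget hsep ha hω hst hb).2 h),
    (mem_clus_iff_gadget hsep ha hω hst hc).1 hOc,
    fun h => hKc ((mem_clus_iff_gadget hsep ha hω hst hc).2 h),
    fun h => hbc (region_of_gadget hsep ha hb hω hst h)⟩

/-- **`R` transfers back from the gadget system.**  Same state, `a, b, c` non-interior: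
`ω' ∈ R(G'; a, b, c) ⟹ ω ∈ R(G; a, b, c)`. [this work] -/
theorem mem_rSet_of_mem_rSet_gadget {b c : V}
    (hsep : ∀ w i, w ∈ ends₁ i → ∀ j, w ∈ ends₂ j → w = u ∨ w = v)
    (ha : ∀ j, a ∈ ends₂ j → a = u ∨ a = v) (hb : ∀ j, b ∈ ends₂ j → b = u ∨ b = v)
    (hc : ∀ j, c ∈ ends₂ j → c = u ∨ c = v)
    (hω : ∀ i, ω (Sum.inl i) = ω' (Sum.inl i))
    (hst : ∀ col, v ∈ clus ends₂ (fun j => ω (Sum.inr j)) col u ↔ (u = v ∨ ∃ k, ω' (Sum.inr k) = col))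
    (hx : ω' ∈ rSet (Sum.elim ends₁ (fun _ : κ => s(u, v))) a b c) :
    ω ∈ rSet (Sum.elim ends₁ ends₂) a b c := by
  classical
  obtain ⟨hOb, hKb, hKc, hOc⟩ := (mem_filter.1 hx).2
  exact mem_filter.2 ⟨mem_univ _, (mem_clus_iff_gadget hsep ha hω hst hb).2 hOb,
    fun h => hKb ((mem_clus_iff_gadget hsep ha hω hst hb).1 h),
    (mem_clus_iff_gadget hsep ha hω hst hc).2 hKc,
    fun h => hOc ((mem_clus_iff_gadget hsep ha hω hst hc).1 h)⟩

end Gadget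

section Bare

/-! ### The glued system versus the bare side `G₁` (state: joined by neither colour) -/

variable {ends₁ : ι₁ → Sym2 V} {ends₂ : ι₂ → Sym2 V} {u v a : V} {ω : ι₁ ⊕ ι₂ → Bool}

/-- **Regions, bare side.**  If `u, v` are not closed-joined inside `G₂` and `b` is non-interior, a
support path of `G₁` from `b` avoiding `K_a` of `G₁` is a support path of `G` avoiding `K_a(ω)`.
[this work] -/
theorem region_of_inl {b : V}
    (hsep : ∀ w i, w ∈ ends₁ i → ∀ j, w ∈ ends₂ j → w = u ∨ w = v)
    (ha : ∀ j, a ∈ ends₂ j → a = u ∨ a = v) (hb : ∀ j, b ∈ ends₂ j → b = u ∨ b = v)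
    (hK : v ∉ clus ends₂ (fun j => ω (Sum.inr j)) false u)
    {x : V} (hx : x ∈ region ends₁ (fun i => ω (Sum.inl i)) a b) :
    x ∈ region (Sum.elim ends₁ ends₂) ω a b := by
  rw [mem_region] at hx ⊢
  suffices h : (∀ j, x ∈ ends₂ j → x = u ∨ x = v) ∧
      ReflTransGen (fun p q => q ∈ freeNbr (Sum.elim ends₁ ends₂) ω a p) b x from h.2
  induction hx with
  | refl => exact ⟨hb, ReflTransGen.refl⟩
  | @tail y z _ hyz ih =>
    obtain ⟨⟨i, hi⟩, hyK', hzK'⟩ := hyz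
    have hzN : ∀ j, z ∈ ends₂ j → z = u ∨ z = v :=
      hsep z i (by rw [hi]; exact Sym2.mem_mk_right _ _)
    have hyK : y ∉ clus (Sum.elim ends₁ ends₂) ω false a :=
      fun h => hyK' ((mem_clus_iff_inl_of_not_joined hsep ha hK ih.1).1 h)
    have hzK : z ∉ clus (Sum.elim ends₁ ends₂) ω false a :=
      fun h => hzK' ((mem_clus_iff_inl_of_not_joined hsep ha hK hzN).1 h)
    exact ⟨hzN, ih.2.tail ⟨⟨Sum.inl i, hi⟩, hyK, hzK⟩⟩

variable [Fintype ι₁] [DecidableEq ι₁] [Fintype ι₂] [DecidableEq ι₂]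

/-- **`L` transfers to the bare side.**  If `u, v` are joined inside `G₂` by neither colour and
`a, b, c` are non-interior: `ω ∈ L(G; a, b, c) ⟹ ω|_{G₁} ∈ L(G₁; a, b, c)`. [this work] -/
theorem mem_lSet_inl_of_mem_lSet {b c : V}
    (hsep : ∀ w i, w ∈ ends₁ i → ∀ j, w ∈ ends₂ j → w = u ∨ w = v)
    (ha : ∀ j, a ∈ ends₂ j → a = u ∨ a = v) (hb : ∀ j, b ∈ ends₂ j → b = u ∨ b = v)
    (hc : ∀ j, c ∈ ends₂ j → c = u ∨ c = v)
    (hO : v ∉ clus ends₂ (fun j => ω (Sum.inr j)) true u)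
    (hK : v ∉ clus ends₂ (fun j => ω (Sum.inr j)) false u)
    (hx : ω ∈ lSet (Sum.elim ends₁ ends₂) a b c) :
    (fun i => ω (Sum.inl i)) ∈ lSet ends₁ a b c := by
  classical
  obtain ⟨hOb, hKb, hOc, hKc, hbc⟩ := (mem_filter.1 hx).2
  refine mem_filter.2 ⟨mem_univ _, (mem_clus_iff_inl_of_not_joined hsep ha hO hb).1 hOb,
    fun h => hKb ((mem_clus_iff_inl_of_not_joined hsep ha hK hb).2 h),
    (mem_clus_iff_inl_of_not_joined hsep ha hO hc).1 hOc,
    fun h => hKc ((mem_clus_iff_inl_of_not_joined hsep ha hK hc).2 h),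
    fun h => hbc (region_of_inl hsep ha hb hK h)⟩

/-- **`R` transfers back from the bare side.**  If `u, v` are joined inside `G₂` by neither colour and
`a, b, c` are non-interior: `ω|_{G₁} ∈ R(G₁; a, b, c) ⟹ ω ∈ R(G; a, b, c)`. [this work] -/
theorem mem_rSet_of_mem_rSet_inl {b c : V}
    (hsep : ∀ w i, w ∈ ends₁ i → ∀ j, w ∈ ends₂ j → w = u ∨ w = v)
    (ha : ∀ j, a ∈ ends₂ j → a = u ∨ a = v) (hb : ∀ j, b ∈ ends₂ j → b = u ∨ b = v)
    (hc : ∀ j, c ∈ ends₂ j → c = u ∨ c = v)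
    (hO : v ∉ clus ends₂ (fun j => ω (Sum.inr j)) true u)
    (hK : v ∉ clus ends₂ (fun j => ω (Sum.inr j)) false u)
    (hx : (fun i => ω (Sum.inl i)) ∈ rSet ends₁ a b c) :
    ω ∈ rSet (Sum.elim ends₁ ends₂) a b c := by
  classical
  obtain ⟨hOb, hKb, hKc, hOc⟩ := (mem_filter.1 hx).2
  exact mem_filter.2 ⟨mem_univ _, (mem_clus_iff_inl_of_not_joined hsep ha hO hb).2 hOb,
    fun h => hKb ((mem_clus_iff_inl_of_not_joined hsep ha hK hb).1 h),
    (mem_clus_iff_inl_of_not_joined hsep ha hK hc).2 hKc,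
    fun h => hOc ((mem_clus_iff_inl_of_not_joined hsep ha hO hc).1 h)⟩

end Bare

end AntipodalR1

end Summit.CriticalPhenomena.PercolationContinuityZ3.Theorems
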